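import Summits.AtomisticToContinuum.Crystallization.Theorems.ChargedEnergyGapReachDial
import Literature.MathematicalPhysics.StatisticalMechanics.BarlowCovering

/-!
# `PricedLinkCensus.ChargedEnergyGap` (stmt-AtomisticToContinuum-14231) — the COHERENCE dial, part H-A: Barlow images, coherent surroundings,
# the coherence split of the interfacial species (decomp-a2c lens 3, generation 46; RE-ISSUED generation 47 with the image window re-pointed
# to the configuration's own scale — critic row 901 (a′)(β); over part G `ChargedEnergyGapReachDial`; critic rows 881 (1) / 894 / 901)

The G-side line of record is `[G] GrossChargeGap (3/20) ⟺ IP ∧ IDP(40) ∧ FCP(40)` (part G): the engine target IDP prices the INTERFACIAL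
deep-rigid cores — compact gross charged motif sites, `(10, 1/100)`-rigid in every presentation, with a charge-free particle within
reach `40` — by «incompatibility pricing over the chart frames within reach».  That engine (Read–Shockley, Lauteri–Luckhaus, geometric
rigidity) prices exactly ONE thing: a HOLONOMY — the impossibility of continuing one rigid crystal frame around the defect.  This file TYPES
that datum as a predicate on points of space and cuts the interfacial species by it.

§1 `IsBarlowImage S`: `S` is a rigid copy `g '' barlowStacking a h s` of a Barlow packing — ANY Hägg stacking `s` (fcc, hcp, faulted,
   polytypic: stacking disorder is NOT holonomy and costs `≈ 10⁻³` per site, so it must not be sorted as a defect), relaxation spacings AT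
   THE CONFIGURATION'S OWN SCALE: `a ∈ [9/10, 11/10]` and `h/a ∈ √(2/3)·[9/10, 11/10]` (typed square-free as `27/50·a² ≤ h² ≤ 121/150·a²`,
   `0 < h`; the Lennard-Jones spacing is `≈ 0.97`, the ideal ratio `h/a = √(2/3)`; the window absorbs dilations up to `±10 %`, far above
   the `≈ 1/200` a charge-free neighbourhood can carry, and EXCLUDES the DENSE images of the g46 window `[1/2, 2]²` — `a = h = 1/2`, padded
   Hägg words at `h < √(2/3)` — which contain unit fcc together with non-lattice cosets and therefore fitted two perfect domains related
   by a rigid non-lattice, non-fault translation with `δ = 0` (critic row 901 (a′)): under this window such translation-domain walls and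
   pockets are INCOHERENT and belong to the engine target, as they should; every image is `1/2`-separated, `IsBarlowImage.le_dist`),
   `g` an isometry of space.  `CoherentWithin δ L' Q p`: ONE Barlow image passes within `δ` of EVERY
   charge-free point of `Q` within `L'` of `p` — label-free, one-sided, sup-norm.  Its negation is the typed holonomy datum: every rigid
   Barlow frame is contradicted, within reach, by a charge-free (under the P-side dictionary: a CHARTED) point more than `δ` off it
   (`exists_chargeFree_misfit`, `exists_charted_misfit`).  Only reads the point set, period invariant, monotone in `δ`, antitone in `L'`;
   TWO TYPED ENDS: `δ < 0` — coherent ⟺ no crystal within `L'`; `δ ≥ 5/8` — everything is coherent (covering radius `√(343/900) < 5/8`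
   of the `a = 9/10, h = 2/3` image, `Literature…BarlowCovering`), so the window on `a, h` is exactly what makes the dial non-degenerate
   in between (all other theorems are window-agnostic).
§2 THE COHERENCE SPLIT (exact, every `θ ε R r η L δ L'`): interfacial = INCOHERENT + COHERENT,
   `motifCoreInterfacial_eq_incoherent_add_coherent`; the incoherent species has crystal within `L'` automatically.
RECORD LITERALS.  `δ = 1/10`: the smallest fit deficit of a topological defect of a close packing along a circuit of charge-free points is
`min_{t ∈ S} dist(b, t)/2`-type — half a Shockley partial `≈ 0.29`, half a stair-rod `1/6 ≈ 0.17`, half a perfect Burgers vector `0.49`, a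
tilt wall `ϑ·L' ≥ 0.1` down to `ϑ ≈ 0.14°` (below which its dislocations are `≥ 400` apart and individually incoherent) — all `> 1/10`;
the free spacing `a` absorbs dilation, but a deviatoric strain `ε` across the whole reach drifts a rigid fit by `≈ ε·L'`, and charge at
tolerance `1/100` survives strains up to `≈ 1/200`: a dislocation-free but strained neighbourhood (`1/400 < ε ≤ 1/200` over the full
`40`-ball) is therefore sorted INCOHERENT («elastic incoherence») — priced by the engine's first term (the ball's elastic energy
`≈ ½ μ ε² ρ |B₄₀| ≳ 5`) or removed by dialling `δ` up to `1/5` (`CoherentWithin.mono`; admissible: every zoo deficit is `≥ 1/6`, and faults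
on non-parallel planes keep stacking-fault tetrahedra / Lomer–Cottrell locks at `≥ 0.29`).  `L' = L = 40`: the circuit must run in
charge-free crystal, i.e. beyond the strain halo `≈ 16–24` of a core.

Part H-B `ChargedEnergyGapCoherencePricing` carries the pieces (CCP, NCP, the maximal debit NGP), the exact iffs, the record cone and the TAGS.
All `[this work]`; Barlow point sets and their covering radius from `Literature.MathematicalPhysics.StatisticalMechanics.{BarlowStacking,
BarlowCovering}` (Conway–Sloane Ch. 1 §1.3, Ch. 4 §6); period invariance of charge from part F-A (`isChargeFree_add_period`).
-/

noncomputable section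

open scoped Classical
open Literature.MathematicalPhysics.StatisticalMechanics
open Literature.Geometry.DiscreteGeometry
open Summit.AtomisticToContinuum.Crystallization.Theses.PricedLinkCensus
open Summit.AtomisticToContinuum.Crystallization.Theorems.ChargedEnergyGapNegative

namespace Summit.AtomisticToContinuum.Crystallization.Theorems.ChargedEnergyGapChartDial

/-! ## §1 Barlow images and coherent surroundings -/

/-- A **BARLOW IMAGE**: a rigid copy `g '' barlowStacking a h s` of a Barlow packing at the configuration's own scale — in-layer spacing
`a ∈ [9/10, 11/10]`, layer spacing `h > 0` with `h/a ∈ √(2/3)·[9/10, 11/10]`, i.e. `27/50·a² ≤ h² ≤ 121/150·a²` (relaxation parameters;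
the Lennard-Jones spacing is `≈ 0.97`, the ideal ratio `√(2/3)`; re-pointed in generation 47 from `[1/2, 2]²`, critic row 901 (a′)(β)),
ANY Hägg sequence `s`, `g` an isometry of space. -/
def IsBarlowImage (S : Set E3) : Prop :=
  ∃ (a h : ℝ) (s : ℤ → ℤ) (g : E3 → E3),
    (9 / 10 ≤ a ∧ a ≤ 11 / 10) ∧ (0 < h ∧ 27 / 50 * a ^ 2 ≤ h ^ 2 ∧ h ^ 2 ≤ 121 / 150 * a ^ 2) ∧
      IsHaggSeq s ∧ Isometry g ∧ S = g '' barlowStacking a h s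

/-- The window's floors: `a ≥ 9/10` and `h ≥ 13/20` (from `h² ≥ 27/50·(9/10)² = 2187/5000 > (13/20)²`). -/
theorem IsBarlowImage.window_floor {a h : ℝ} (ha : 9 / 10 ≤ a ∧ a ≤ 11 / 10)
    (hh : 0 < h ∧ 27 / 50 * a ^ 2 ≤ h ^ 2 ∧ h ^ 2 ≤ 121 / 150 * a ^ 2) : 9 / 10 ≤ a ∧ 13 / 20 ≤ h := by
  refine ⟨ha.1, ?_⟩
  have ha2 : (81 / 100 : ℝ) ≤ a ^ 2 := by nlinarith [ha.1]
  by_contra hlt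
  push Not at hlt
  nlinarith [hh.2.1, mul_pos hh.1 (sub_pos.2 hlt)]

/-- Every admissible Barlow stacking is a Barlow image (identity motion). -/
theorem isBarlowImage_barlowStacking {a h : ℝ} (ha : 9 / 10 ≤ a ∧ a ≤ 11 / 10)
    (hh : 0 < h ∧ 27 / 50 * a ^ 2 ≤ h ^ 2 ∧ h ^ 2 ≤ 121 / 150 * a ^ 2) {s : ℤ → ℤ} (hs : IsHaggSeq s) :
    IsBarlowImage (barlowStacking a h s) :=
  ⟨a, h, s, id, ha, hh, hs, isometry_id, (Set.image_id _).symm⟩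

/-- Barlow images are closed under translation (compose the motion with the translation). -/
theorem IsBarlowImage.translate {S : Set E3} (hS : IsBarlowImage S) (v : E3) : IsBarlowImage ((fun x => x + v) '' S) := by
  obtain ⟨a, h, s, g, ha, hh, hs, hg, rfl⟩ := hS
  refine ⟨a, h, s, fun x => g x + v, ha, hh, hs, Isometry.of_dist_eq fun x y => by rw [dist_add_right, hg.dist_eq], ?_⟩
  rw [Set.image_image]

/-- ★ **Non-degeneracy of the fit**: a Barlow image is `1/2`-separated (indeed `13/20`-separated; so a `δ`-fit with `δ < 1/4` never uses one
image point for two `1/2`-separated particles, and no image passes within `δ` of everything — contrast `coherentWithin_of_five_eighths_le`). -/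
theorem IsBarlowImage.le_dist {S : Set E3} (hS : IsBarlowImage S) {x y : E3} (hx : x ∈ S) (hy : y ∈ S) (hxy : x ≠ y) :
    1 / 2 ≤ dist x y := by
  obtain ⟨a, h, s, g, ha, hh, _, hg, rfl⟩ := hS
  obtain ⟨x₀, hx₀, rfl⟩ := hx
  obtain ⟨y₀, hy₀, rfl⟩ := hy
  have hne : x₀ ≠ y₀ := fun h0 => hxy (by rw [h0])
  obtain ⟨ha', hh'⟩ := IsBarlowImage.window_floor ha hh
  rw [hg.dist_eq]
  exact (le_min (by linarith) (by linarith)).trans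
    (le_dist_of_mem_barlowStacking (a := a) (h := h) (s := s) (by linarith) (by linarith) hx₀ hy₀ hne)

/-- **COHERENT SURROUNDINGS** within reach `L'` at fit tolerance `δ`: ONE Barlow image passes within `δ` of every charge-free point of `Q`
(tolerance `1/100`) within distance `L'` of the point `p` of space.  Its negation is the typed HOLONOMY datum (`exists_chargeFree_misfit`). -/
def CoherentWithin (δ L' : ℝ) (Q : PeriodicConfiguration 3) (p : E3) : Prop :=
  ∃ S : Set E3, IsBarlowImage S ∧ ∀ (q : E3) (hq : q ∈ Q.points),
    IsChargeFree (1 / 100) (Subtype.val : Q.points → E3) ⟨q, hq⟩ → dist p q ≤ L' → ∃ b ∈ S, dist q b ≤ δ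

/-- Coherence is monotone in the tolerance and antitone in the reach. -/
theorem CoherentWithin.mono {δ δ' L' L'' : ℝ} (hδ : δ ≤ δ') (hL : L'' ≤ L') {Q : PeriodicConfiguration 3} {p : E3}
    (h : CoherentWithin δ L' Q p) : CoherentWithin δ' L'' Q p := by
  obtain ⟨S, hS, hfit⟩ := h
  refine ⟨S, hS, fun q hq hc hd => ?_⟩
  obtain ⟨b, hb, hdb⟩ := hfit q hq hc (hd.trans hL)
  exact ⟨b, hb, hdb.trans hδ⟩

/-- No crystal within reach ⟹ coherent (vacuously: any image fits nothing). -/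
theorem coherentWithin_of_not_crystalWithin (δ : ℝ) {L' : ℝ} {Q : PeriodicConfiguration 3} {p : E3} (hp : ¬ CrystalWithin L' Q p) :
    CoherentWithin δ L' Q p :=
  ⟨barlowStacking 1 (4 / 5) constHagg, isBarlowImage_barlowStacking (by norm_num) (by norm_num) isHaggSeq_const,
    fun q hq hc hd => (hp ⟨q, hq, hc, hd⟩).elim⟩

/-- ★ An INCOHERENT point has crystal within its coherence reach. -/
theorem crystalWithin_of_not_coherentWithin {δ L' : ℝ} {Q : PeriodicConfiguration 3} {p : E3} (h : ¬ CoherentWithin δ L' Q p) :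
    CrystalWithin L' Q p := by
  by_contra h'
  exact h (coherentWithin_of_not_crystalWithin δ h')

/-- ★ **THE HOLONOMY DATUM, TYPED** (negation unfolded): `p` is incoherent iff EVERY Barlow image is contradicted by a charge-free point of
`Q` within `L'` of `p` lying more than `δ` off the image. -/
theorem not_coherentWithin_iff {δ L' : ℝ} {Q : PeriodicConfiguration 3} {p : E3} :
    ¬ CoherentWithin δ L' Q p ↔ ∀ S : Set E3, IsBarlowImage S → ∃ (q : E3) (hq : q ∈ Q.points),
      IsChargeFree (1 / 100) (Subtype.val : Q.points → E3) ⟨q, hq⟩ ∧ dist p q ≤ L' ∧ ∀ b ∈ S, δ < dist q b := by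
  constructor
  · intro h S hS
    by_contra hcon
    push Not at hcon
    exact h ⟨S, hS, hcon⟩
  · rintro h ⟨S, hS, hfit⟩
    obtain ⟨q, hq, hc, hd, hfar⟩ := h S hS
    obtain ⟨b, hb, hdb⟩ := hfit q hq hc hd
    exact (not_le.2 (hfar b hb)) hdb

/-- The misfit witness against a given image. -/
theorem exists_chargeFree_misfit {δ L' : ℝ} {Q : PeriodicConfiguration 3} {p : E3} (h : ¬ CoherentWithin δ L' Q p) {S : Set E3}
    (hS : IsBarlowImage S) : ∃ (q : E3) (hq : q ∈ Q.points),
      IsChargeFree (1 / 100) (Subtype.val : Q.points → E3) ⟨q, hq⟩ ∧ dist p q ≤ L' ∧ ∀ b ∈ S, δ < dist q b :=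
  not_coherentWithin_iff.1 h S hS

/-- ★ **The engine's input** under the P-side dictionary `ChargeFreeCharted θ`: at an incoherent point every rigid Barlow frame is
contradicted within reach by a `θ`-CHARTED point of `Q` (an fcc / hcp chart) more than `δ` off it — incompatibility of charts, by name. -/
theorem exists_charted_misfit {θ δ L' : ℝ} (hD : ChargeFreeCharted θ) {Q : PeriodicConfiguration 3} {p : E3}
    (h : ¬ CoherentWithin δ L' Q p) {S : Set E3} (hS : IsBarlowImage S) :
    ∃ (q : E3) (hq : q ∈ Q.points), ChartedAt θ Q ⟨q, hq⟩ ∧ dist p q ≤ L' ∧ ∀ b ∈ S, δ < dist q b := by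
  obtain ⟨q, hq, hc, hd, hfar⟩ := exists_chargeFree_misfit h hS
  exact ⟨q, hq, hD Q ⟨q, hq⟩ hc, hd, hfar⟩

/-- Dial end `δ < 0`: coherent ⟺ no crystal within reach. -/
theorem coherentWithin_iff_not_crystalWithin_of_neg {δ : ℝ} (hδ : δ < 0) (L' : ℝ) (Q : PeriodicConfiguration 3) (p : E3) :
    CoherentWithin δ L' Q p ↔ ¬ CrystalWithin L' Q p := by
  constructor
  · rintro ⟨S, hS, hfit⟩ ⟨q, hq, hc, hd⟩
    obtain ⟨b, hb, hdb⟩ := hfit q hq hc hd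
    exact (not_le.2 hδ) (dist_nonneg.trans hdb)
  · exact coherentWithin_of_not_crystalWithin δ

/-- ★ Dial end `δ ≥ 5/8`: EVERYTHING is coherent — the densest admissible image, `a = 9/10, h = 2/3` fcc, has covering radius
`√(a²/3 + h²/4) = √(343/900) ≈ 0.617 < 5/8` (the Literature's `exists_mem_barlowStacking_dist_sq_le`).  This is why the window on the
spacings is part of the definition (g46's window `[1/2, 2]²` put this end at `2/5`). -/
theorem coherentWithin_of_five_eighths_le {δ : ℝ} (hδ : 5 / 8 ≤ δ) (L' : ℝ) (Q : PeriodicConfiguration 3) (p : E3) :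
    CoherentWithin δ L' Q p := by
  refine ⟨barlowStacking (9 / 10) (2 / 3) constHagg,
    isBarlowImage_barlowStacking ⟨le_rfl, by norm_num⟩ ⟨by norm_num, by norm_num, by norm_num⟩ isHaggSeq_const, fun q hq _ _ => ?_⟩
  obtain ⟨z, hz, hd⟩ :=
    exists_mem_barlowStacking_dist_sq_le (a := 9 / 10) (by norm_num) (h := 2 / 3) (by norm_num) constHagg q
  refine ⟨z, hz, ?_⟩
  by_contra hlt
  have hlt' : δ < dist q z := lt_of_not_ge hlt
  have h1 : δ * δ < dist q z * dist q z := mul_self_lt_mul_self (by linarith) hlt'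
  nlinarith [hd, hδ, h1]

/-- ★ Coherence is invariant under the periods of `Q` (translate the image and the charge-free witnesses; charge is period invariant). -/
theorem coherentWithin_add_period (δ L' : ℝ) (Q : PeriodicConfiguration 3) {g : E3} (hg : g ∈ Q.lattice) (p : E3) :
    CoherentWithin δ L' Q (p + g) ↔ CoherentWithin δ L' Q p := by
  constructor
  · rintro ⟨S, hS, hfit⟩
    refine ⟨(fun x => x + -g) '' S, hS.translate (-g), fun q hq hc hd => ?_⟩
    have hqg : q + g ∈ Q.points := Q.add_mem_points hq hg
    obtain ⟨b, hb, hdb⟩ :=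
      hfit (q + g) hqg ((isChargeFree_add_period (1 / 100) Q hg hq hqg).2 hc) (by rwa [dist_add_right])
    refine ⟨b + -g, Set.mem_image_of_mem _ hb, ?_⟩
    have h1 : dist q (b + -g) = dist (q + g) b := by rw [dist_eq_norm, dist_eq_norm]; congr 1; abel
    rwa [h1]
  · rintro ⟨S, hS, hfit⟩
    refine ⟨(fun x => x + g) '' S, hS.translate g, fun q hq hc hd => ?_⟩
    have hg' : -g ∈ Q.lattice := Q.lattice.neg_mem hg
    have hqg : q + -g ∈ Q.points := Q.add_mem_points hq hg'
    have h2 : dist p (q + -g) = dist (p + g) q := by rw [dist_eq_norm, dist_eq_norm]; congr 1; abel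
    obtain ⟨b, hb, hdb⟩ := hfit (q + -g) hqg ((isChargeFree_add_period (1 / 100) Q hg' hq hqg).2 hc) (by rwa [h2])
    refine ⟨b + g, Set.mem_image_of_mem _ hb, ?_⟩
    have h1 : dist q (b + g) = dist (q + -g) b := by rw [dist_eq_norm, dist_eq_norm]; congr 1; abel
    rwa [h1]

/-- ★ Coherence only reads the point set. -/
theorem coherentWithin_congr_points (δ L' : ℝ) {P Q : PeriodicConfiguration 3} (h : P.points = Q.points) (p : E3) :
    CoherentWithin δ L' P p ↔ CoherentWithin δ L' Q p := by
  simp only [CoherentWithin]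
  rw [h]

/-- In a supercell presentation coherence is read exactly as in the original presentation. -/
theorem coherentWithin_of_isSupercell {k : ℕ} {Q P : PeriodicConfiguration 3} (hS : IsSupercell k Q P) (δ L' : ℝ) (p : E3) :
    CoherentWithin δ L' P p ↔ CoherentWithin δ L' Q p :=
  coherentWithin_congr_points δ L' hS.1 p

/-! ## §2 The coherence split of the interfacial species -/

/-- Number of COHERENT interfacial cores: deep-rigid compact gross charged motif sites with crystal within reach `L` whose charge-free
surroundings within `L'` fit one rigid Barlow frame to `δ` (the declared sub-residual #2's species). -/
def motifCoreCoherent (θ ε R r η L δ L' : ℝ) (Q : PeriodicConfiguration 3) : ℕ :=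
  Nat.card {x : Q.motif //
    (((((Charged Q x ∧ ¬ ChartedAt θ Q (pt Q x)) ∧ ¬ Exposed ε R Q x) ∧ ¬ Improvable r η Q x) ∧ ¬ DeepImprovable r η Q x) ∧
      CrystalWithin L Q (x : E3)) ∧ CoherentWithin δ L' Q (x : E3)}

/-- Number of INCOHERENT interfacial cores: the same species carrying a HOLONOMY at `(δ, L')` (the engine target's species). -/
def motifCoreIncoherent (θ ε R r η L δ L' : ℝ) (Q : PeriodicConfiguration 3) : ℕ :=
  Nat.card {x : Q.motif //
    (((((Charged Q x ∧ ¬ ChartedAt θ Q (pt Q x)) ∧ ¬ Exposed ε R Q x) ∧ ¬ Improvable r η Q x) ∧ ¬ DeepImprovable r η Q x) ∧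
      CrystalWithin L Q (x : E3)) ∧ ¬ CoherentWithin δ L' Q (x : E3)}

/-- ★ interfacial = incoherent + coherent, every `θ ε R r η L δ L'`. -/
theorem motifCoreInterfacial_eq_incoherent_add_coherent (θ ε R r η L δ L' : ℝ) (Q : PeriodicConfiguration 3) :
    motifCoreInterfacial θ ε R r η L Q = motifCoreIncoherent θ ε R r η L δ L' Q + motifCoreCoherent θ ε R r η L δ L' Q :=
  natCard_subtype_split
    (fun x : Q.motif =>
      ((((Charged Q x ∧ ¬ ChartedAt θ Q (pt Q x)) ∧ ¬ Exposed ε R Q x) ∧ ¬ Improvable r η Q x) ∧ ¬ DeepImprovable r η Q x) ∧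
        CrystalWithin L Q (x : E3))
    (fun x => CoherentWithin δ L' Q (x : E3))

/-- ★ **THE SIX-SPECIES CENSUS** of the gross charged motif sites: exposed + improvable + shallow-rigid + frustrated + coherent + incoherent. -/
theorem motifChargedGross_eq_six_species (θ ε R r η L δ L' : ℝ) (Q : PeriodicConfiguration 3) :
    motifChargedGross θ Q = motifGrossExposed θ ε R Q + motifCompactImprovable θ ε R r η Q + motifCompactShallow θ ε R r η Q +
      motifCoreFrustrated θ ε R r η L Q + motifCoreCoherent θ ε R r η L δ L' Q + motifCoreIncoherent θ ε R r η L δ L' Q := by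
  rw [motifChargedGross_eq_compact_add_exposed θ ε R, motifGrossCompact_eq_rigid_add_improvable θ ε R r η,
    motifCompactRigid_eq_deepRigid_add_shallow, motifCompactDeepRigid_eq_frustrated_add_interfacial θ ε R r η L,
    motifCoreInterfacial_eq_incoherent_add_coherent θ ε R r η L δ L']
  omega

/-- The coherent cores are among the interfacial cores. -/
theorem motifCoreCoherent_le (θ ε R r η L δ L' : ℝ) (Q : PeriodicConfiguration 3) :
    motifCoreCoherent θ ε R r η L δ L' Q ≤ motifCoreInterfacial θ ε R r η L Q := by
  rw [motifCoreInterfacial_eq_incoherent_add_coherent θ ε R r η L δ L' Q]; exact Nat.le_add_left _ _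

/-- The incoherent cores are among the interfacial cores. -/
theorem motifCoreIncoherent_le (θ ε R r η L δ L' : ℝ) (Q : PeriodicConfiguration 3) :
    motifCoreIncoherent θ ε R r η L δ L' Q ≤ motifCoreInterfacial θ ε R r η L Q := by
  rw [motifCoreInterfacial_eq_incoherent_add_coherent θ ε R r η L δ L' Q]; exact Nat.le_add_right _ _

/-- Incoherent cores are gross charged motif sites (the debit of NGP is a genuine count). -/
theorem motifCoreIncoherent_le_gross (θ ε R r η L δ L' : ℝ) (Q : PeriodicConfiguration 3) :
    motifCoreIncoherent θ ε R r η L δ L' Q ≤ motifChargedGross θ Q := by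
  rw [motifChargedGross_eq_six_species θ ε R r η L δ L' Q]; exact Nat.le_add_left _ _

/-- The coherent count grows with `δ` and shrinks with `L'`. -/
theorem motifCoreCoherent_mono {θ ε R r η L δ δ' L' L'' : ℝ} (hδ : δ ≤ δ') (hL : L'' ≤ L') (Q : PeriodicConfiguration 3) :
    motifCoreCoherent θ ε R r η L δ L' Q ≤ motifCoreCoherent θ ε R r η L δ' L'' Q :=
  Nat.card_le_card_of_injective (fun x => ⟨x.1, x.2.1, x.2.2.mono hδ hL⟩) fun _ _ hab => Subtype.ext (Subtype.mk.inj hab)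

/-- The incoherent count shrinks with `δ` and grows with `L'`. -/
theorem motifCoreIncoherent_anti {θ ε R r η L δ δ' L' L'' : ℝ} (hδ : δ ≤ δ') (hL : L'' ≤ L') (Q : PeriodicConfiguration 3) :
    motifCoreIncoherent θ ε R r η L δ' L'' Q ≤ motifCoreIncoherent θ ε R r η L δ L' Q :=
  Nat.card_le_card_of_injective (fun x => ⟨x.1, x.2.1, fun h0 => x.2.2 (h0.mono hδ hL)⟩)
    fun _ _ hab => Subtype.ext (Subtype.mk.inj hab)

/-- ★ An incoherent core has crystal within `L'` as well (the species is interfacial at both reaches). -/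
theorem crystalWithin_of_mem_incoherent {θ ε R r η L δ L' : ℝ} {Q : PeriodicConfiguration 3}
    (x : {x : Q.motif //
      (((((Charged Q x ∧ ¬ ChartedAt θ Q (pt Q x)) ∧ ¬ Exposed ε R Q x) ∧ ¬ Improvable r η Q x) ∧ ¬ DeepImprovable r η Q x) ∧
        CrystalWithin L Q (x : E3)) ∧ ¬ CoherentWithin δ L' Q (x : E3)}) : CrystalWithin L' Q (x.1 : E3) :=
  crystalWithin_of_not_coherentWithin x.2.2

/-- Dial end `δ < 0` (with `L ≤ L'`): no coherent core … -/
theorem motifCoreCoherent_eq_zero_of_neg {θ ε R r η L δ L' : ℝ} (hδ : δ < 0) (hL : L ≤ L') (Q : PeriodicConfiguration 3) :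
    motifCoreCoherent θ ε R r η L δ L' Q = 0 := by
  haveI : IsEmpty {x : Q.motif //
      (((((Charged Q x ∧ ¬ ChartedAt θ Q (pt Q x)) ∧ ¬ Exposed ε R Q x) ∧ ¬ Improvable r η Q x) ∧ ¬ DeepImprovable r η Q x) ∧
        CrystalWithin L Q (x : E3)) ∧ CoherentWithin δ L' Q (x : E3)} :=
    ⟨fun x => ((coherentWithin_iff_not_crystalWithin_of_neg hδ L' Q _).1 x.2.2) (x.2.1.2.mono hL)⟩
  exact Nat.card_of_isEmpty

/-- … so every interfacial core is incoherent. -/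
theorem motifCoreIncoherent_eq_of_neg {θ ε R r η L δ L' : ℝ} (hδ : δ < 0) (hL : L ≤ L') (Q : PeriodicConfiguration 3) :
    motifCoreIncoherent θ ε R r η L δ L' Q = motifCoreInterfacial θ ε R r η L Q := by
  rw [motifCoreInterfacial_eq_incoherent_add_coherent θ ε R r η L δ L' Q, motifCoreCoherent_eq_zero_of_neg hδ hL, add_zero]

/-- Dial end `δ ≥ 5/8`: no incoherent core … -/
theorem motifCoreIncoherent_eq_zero_of_five_eighths_le {θ ε R r η L δ L' : ℝ} (hδ : 5 / 8 ≤ δ) (Q : PeriodicConfiguration 3) :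
    motifCoreIncoherent θ ε R r η L δ L' Q = 0 := by
  haveI : IsEmpty {x : Q.motif //
      (((((Charged Q x ∧ ¬ ChartedAt θ Q (pt Q x)) ∧ ¬ Exposed ε R Q x) ∧ ¬ Improvable r η Q x) ∧ ¬ DeepImprovable r η Q x) ∧
        CrystalWithin L Q (x : E3)) ∧ ¬ CoherentWithin δ L' Q (x : E3)} :=
    ⟨fun x => x.2.2 (coherentWithin_of_five_eighths_le hδ L' Q _)⟩
  exact Nat.card_of_isEmpty

/-- … so every interfacial core is coherent. -/
theorem motifCoreCoherent_eq_of_five_eighths_le {θ ε R r η L δ L' : ℝ} (hδ : 5 / 8 ≤ δ) (Q : PeriodicConfiguration 3) :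
    motifCoreCoherent θ ε R r η L δ L' Q = motifCoreInterfacial θ ε R r η L Q := by
  rw [motifCoreInterfacial_eq_incoherent_add_coherent θ ε R r η L δ L' Q, motifCoreIncoherent_eq_zero_of_five_eighths_le hδ, zero_add]

end Summit.AtomisticToContinuum.Crystallization.Theorems.ChargedEnergyGapChartDial

end
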